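import Mathlib
import HarnessLib
import Summits.Ventures.LatticeQCDFlow.Exactness.NCMCGeneralSpaceMeanWorkTruncation

/-!
# Forward vs reverse Jarzynski estimates: disagreement ≥ the histogram GAP, ≤ the mean HYSTERESIS

HONEST FRAMING: exact (Metropolis-corrected) sampling algorithms for lattice gauge theory;
figures of merit are autocorrelation/cost numbers at stated couplings and volumes; no
continuum-physics claim.

Venture `LatticeQCDFlow` (cell pub-lqcd), topic `Exactness`; FANOUT row 13 (`eng-snf`, GEN-25).
NEW WORK of the cell (finite Jensen, two lines each) on GEN-25's `…MeanWorkTruncation`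
(`min_i W_i ≤ dF_J ≤ mean W` on every record); Mathlib otherwise; not a published result; no
definition; nothing cited as a fact.

WHY (row 13).  `twosided.two_sided_summary` prints the forward Jarzynski value
`fwd.dF = −log mean e^{−W_f}`, the reverse one `rev.minus_dF = −log mean e^{−W_r}` (an estimate of
`−ΔF`), their consistency score `z_fwd_rev = (fwd.dF + rev.minus_dF)/√(err_f² + err_r²)` and the
`crooks_crossing` of the histograms of `W_f` against `−W_r`.  The numerator
`D = fwd.dF + rev.minus_dF` — the disagreement between the forward estimate and the reverse-based
estimate `−rev.minus_dF` of `ΔF` — obeys, on EVERY pair of records and with no model,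

  **`min_i W_{f,i} + min_j W_{r,j} ≤ D ≤ mean W_f + mean W_r`**
  (`inf_add_inf_le_twoSided_sum`, `twoSided_sum_le_avg_add_avg`):

the lower bound is the GAP between the histogram of `W_f` and that of `−W_r`
(`min W_f − max(−W_r)`), the upper bound the total mean HYSTERESIS `⟨W_f⟩ + ⟨W_r⟩`.  Hence
(`twoSided_sum_pos_of_gap`) **if the two histograms do not overlap — every forward work exceeds
every negated reverse work — the two one-sided estimates are NECESSARILY inconsistent, by at least
the gap**: a large positive `z_fwd_rev` is then forced by the data geometry (no crossing bin for
`crooks_crossing` either), while `D < 0` can only come from overlapping records.  In population both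
one-sided estimators are biased upward (`⟨W⟩ ≥ ΔF` each way), so `D` is the natural one-sided alarm.

* **`inf_add_inf_le_twoSided_sum`**, **`twoSided_sum_le_avg_add_avg`**, `twoSided_sum_pos_of_gap`.

NOT CLAIMED: anything stochastic (the law of `z_fwd_rev`); anything numerical.
-/

namespace Summit.Ventures.LatticeQCDFlow.Exactness.GeneralNCMC

open Finset

section TwoSided

variable {ι κ : Type*} [Fintype ι] [Nonempty ι] [Fintype κ] [Nonempty κ]

/-- **GAP ≤ DISAGREEMENT**: `min W_f + min W_r ≤ fwd.dF + rev.minus_dF`. -/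
theorem inf_add_inf_le_twoSided_sum (Wf : ι → ℝ) (Wr : κ → ℝ) :
    univ.inf' univ_nonempty Wf + univ.inf' univ_nonempty Wr
      ≤ -Real.log ((∑ i, Real.exp (-Wf i)) / Fintype.card ι)
          + -Real.log ((∑ j, Real.exp (-Wr j)) / Fintype.card κ) :=
  add_le_add (inf_le_neg_log_avg_exp_neg Wf) (inf_le_neg_log_avg_exp_neg Wr)

/-- **DISAGREEMENT ≤ HYSTERESIS**: `fwd.dF + rev.minus_dF ≤ mean W_f + mean W_r`. -/
theorem twoSided_sum_le_avg_add_avg (Wf : ι → ℝ) (Wr : κ → ℝ) :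
    -Real.log ((∑ i, Real.exp (-Wf i)) / Fintype.card ι)
          + -Real.log ((∑ j, Real.exp (-Wr j)) / Fintype.card κ)
      ≤ (∑ i, Wf i) / Fintype.card ι + (∑ j, Wr j) / Fintype.card κ :=
  add_le_add (neg_log_avg_exp_neg_le_avg Wf) (neg_log_avg_exp_neg_le_avg Wr)

/-- **NO OVERLAP ⇒ INCONSISTENT ONE-SIDED ESTIMATES**: if every forward work exceeds every negated
reverse work with room `min W_f + min W_r > 0`, then `fwd.dF + rev.minus_dF > 0`, i.e. the forward
estimate of `ΔF` lies strictly above the reverse-based one. -/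
theorem twoSided_sum_pos_of_gap (Wf : ι → ℝ) (Wr : κ → ℝ)
    (hgap : 0 < univ.inf' univ_nonempty Wf + univ.inf' univ_nonempty Wr) :
    0 < -Real.log ((∑ i, Real.exp (-Wf i)) / Fintype.card ι)
          + -Real.log ((∑ j, Real.exp (-Wr j)) / Fintype.card κ) :=
  hgap.trans_le (inf_add_inf_le_twoSided_sum Wf Wr)

/-- The gap hypothesis in histogram words: `min W_f + min W_r > 0` iff every forward work exceeds
every negated reverse work by a uniform positive margin — here the pointwise form
`∀ i j, −W_{r,j} < W_{f,i}` follows from it. -/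
theorem neg_lt_of_gap (Wf : ι → ℝ) (Wr : κ → ℝ)
    (hgap : 0 < univ.inf' univ_nonempty Wf + univ.inf' univ_nonempty Wr) (i : ι) (j : κ) :
    -Wr j < Wf i := by
  have hi := inf'_le Wf (mem_univ i)
  have hj := inf'_le Wr (mem_univ j)
  linarith

end TwoSided

end Summit.Ventures.LatticeQCDFlow.Exactness.GeneralNCMC
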